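import Summits.Ventures.PercRepro.RankLevelSetCoreFiveTwentyNine
import Summits.Ventures.PercRepro.RankLevelSetCoreSixFiftyTwo
import Summits.Ventures.PercRepro.RankLevelSetPlaneTenPrime
import Summits.Ventures.PercRepro.RankLevelSetLevelSixArithA

/-!
# PercRepro — THE `e`-FREE CORE AT LEVEL `6`, EVERY CORANK `≥ 51`, EVERY RANK `p ≥ 38` (AND `≥ 52` FROM `p = 37`) —
SELF-CONTAINED (p8 g3, S3)

`proofs/SUBCLAIM-S3-p8.md` §3k / §3m. The content of RankLevelSetCoreSixThirtyNineForty (p399624, landed 12:46Z) +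
…ThirtyNineThirtyEight + …ThirtyNineThirtySeven in ONE module over tree modules with oleans, under primed names — the
olean of the Forty module was not built for more than an hour after its landing (OPS-49), and every assembly of §3k–§3m
needs it. Same proofs, line for line: the `(p − 1)`-subsets with the rank-`≤ 6` sets subtracted
(`choose_le_midCount_add_low'`), `n^6 ≤ 1100·C(n, 6)` from `n ≥ 89` (`pow_six_le_choose_of_89'`), the propagation
`key_of_base'`, the device `core_six_corank_of_key_sub'` (`n₀ ≥ 89`), the keys decided at `n₀ = p + 51` for
`38 ≤ p ≤ 51` (`key_six_sub_of_le_51''`) and at `n₀ = 89 = 37 + 52` (`key_six_sub_37_89'`), and the end theorems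
**`c025_core_six_thirtynine_thirtyeight'`** (`38 ≤ p`, `p + 50 < |E|`) and **`c025_core_six_thirtynine_thirtyseven'`**
(`37 ≤ p`, `p + 51 < |E|`). Axioms: standard.
-/

open scoped Matroid

namespace PercRepro

namespace ThmN

open Set

variable {α : Type}

/-- **`C(n, p − 1) ≤ #Y(p, q) + #{r ≤ q}`**: every `(p − 1)`-subset of `E` has rank `< p`, and lies in `Y` unless its
rank is `≤ q`. No flat clause. -/
theorem choose_le_midCount_add_low' (M : Matroid α) [M.Finite] {p q : ℕ} (hp : 1 ≤ p) :
    M.ground_finite.toFinset.card.choose (p - 1) ≤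
      Matroid.midCount M p q + {X : Set α | X ⊆ M.E ∧ M.eRk X ≤ q}.ncard := by
  have hE : (M.ground_finite.toFinset : Set α) = M.E := Set.Finite.coe_toFinset _
  rw [← ncard_subsets_ncard_eq M.ground_finite.toFinset (p - 1)]
  unfold Matroid.midCount
  refine le_trans (ncard_le_ncard ?_ ?_) (ncard_union_le _ _)
  · intro X hX
    have hXE : X ⊆ M.E := by rw [← hE]; exact hX.1
    have hXfin : X.Finite := M.ground_finite.subset hXE
    by_cases hle : M.eRk X ≤ q
    · exact Or.inr ⟨hXE, hle⟩
    · push Not at hle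
      refine Or.inl ⟨hXE, hle, ?_⟩
      calc M.eRk X ≤ X.encard := M.eRk_le_encard X
        _ = ((p - 1 : ℕ) : ℕ∞) := by rw [← hXfin.cast_ncard_eq, hX.2]
        _ < (p : ℕ∞) := by exact_mod_cast (show p - 1 < p by omega)
  · exact (M.ground_finite.finite_subsets.subset (fun X hX => hX.1)).union
      (M.ground_finite.finite_subsets.subset (fun X hX => hX.1))

/-- `n^6 ≤ 1100·C(n, 6)` for `n ≥ 89` (`720·C(n, 6) = (n−5)(n−4)(n−3)(n−2)(n−1)n`; the polynomial
`1100·Π − 720·n^6` has positive coefficients in `t = n − 89`). -/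
theorem pow_six_le_choose_of_89' (n : ℕ) (hn : 89 ≤ n) : n ^ 6 ≤ 1100 * n.choose 6 := by
  obtain ⟨t, rfl⟩ : ∃ t, n = 89 + t := ⟨n - 89, by omega⟩
  have h := choose_six_mul (83 + t)
  have h6 : (89 + t).choose 6 = (83 + t + 6).choose 6 := by congr 1; ring
  have key : 720 * (89 + t) ^ 6 ≤ 1100 * ((83 + t + 1) * (83 + t + 2) * (83 + t + 3) * (83 + t + 4) *
      (83 + t + 5) * (83 + t + 6)) := by
    ring_nf
    nlinarith [Nat.zero_le t, Nat.zero_le (t ^ 2), Nat.zero_le (t ^ 3), Nat.zero_le (t ^ 4), Nat.zero_le (t ^ 5),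
      Nat.zero_le (t ^ 6)]
  have : 720 * (89 + t) ^ 6 ≤ 720 * (1100 * (89 + t).choose 6) := by
    rw [h6, show 720 * (1100 * (83 + t + 6).choose 6) = 1100 * (720 * (83 + t + 6).choose 6) by ring, h]
    exact key
  exact Nat.le_of_mul_le_mul_left this (by norm_num)

/-- **A key from one instance**: `K·C(n, q) ≤ C·C(n, p − 1)` at `n = n₀` propagates to every `n ≥ n₀`
(`q + 1 ≤ p ≤ n₀ + 1`, `q ≤ n₀`): `C(n, p − 1)/C(n, q)` is non-decreasing in `n` (`choose_ratio_mono_succ`). -/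
theorem key_of_base' (p q K C n₀ : ℕ) (hq : q + 1 ≤ p) (hn₀ : p ≤ n₀ + 1) (hqn : q ≤ n₀)
    (hbase : K * n₀.choose q ≤ C * n₀.choose (p - 1)) :
    ∀ n, n₀ ≤ n → K * n.choose q ≤ C * n.choose (p - 1) := by
  intro n hn
  induction n, hn using Nat.le_induction with
  | base => exact hbase
  | succ n hn ih =>
    have hmono := choose_ratio_mono_succ n p q hq (by omega)
    have hpos : 0 < n.choose q := Nat.choose_pos (by omega)
    refine Nat.le_of_mul_le_mul_right ?_ hpos
    calc K * (n + 1).choose q * n.choose q = (K * n.choose q) * (n + 1).choose q := by ring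
      _ ≤ (C * n.choose (p - 1)) * (n + 1).choose q := Nat.mul_le_mul_right _ ih
      _ = C * (n.choose (p - 1) * (n + 1).choose q) := by ring
      _ ≤ C * ((n + 1).choose (p - 1) * n.choose q) := Nat.mul_le_mul_left _ hmono
      _ = C * (n + 1).choose (p - 1) * n.choose q := by ring

/-- **Regime II at level `6` with the rank-`≤ 6` sets subtracted from the `(p − 1)`-subsets**: for a rank-`p`
`e`-free core on `n ≥ n₀ ≥ 89` elements with the key
`(2^{p+6} + 7700·C(p+6, p))·2^{33}·C(n, 6) ≤ C(p+6, p)·C(n, p − 1)` for every `n ≥ n₀`, `RLS M p 6`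
(`U ≤ C(n, 6)·2^{33}`, `Y ≥ C(n, p − 1) − 7700·2^{33}·C(n, 6)`, `Φ ≤ 2^{p+6}/C(p+6, p)`). -/
theorem core_six_corank_of_key_sub' (n₀ : ℕ) (h89 : 89 ≤ n₀) (M : Matroid α) [M.Finite] (p : ℕ) (hp : 1 ≤ p)
    (hkey : ∀ n, n₀ ≤ n → (2 ^ (p + 6) + 7700 * (p + 6).choose p) * 2 ^ 33 * n.choose 6 ≤
      (p + 6).choose p * n.choose (p - 1))
    (hbig : n₀ ≤ M.E.ncard)
    (hfree : ∀ e ∈ M.E, ∃ A ⊆ M.E \ {e}, e ∉ M.closure A ∧ e ∉ M.closure ((M.E \ {e}) \ A)) : RLS M p 6 := by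
  classical
  set n := M.E.ncard with hn_def
  have hEcard : M.ground_finite.toFinset.card = n := by
    rw [hn_def, Set.ncard_eq_toFinset_card _ M.ground_finite]
  have hBj : ∀ j : ℕ, j ≤ 6 → ∀ X ⊆ M.E, M.eRk X ≤ j → X.ncard + 6 ≤ 39 + j := by
    intro j hj X hX hr
    rcases Nat.lt_or_ge j 4 with h | h
    · have := ncard_add_one_le_two_pow_of_eRk_le M (not_isLoop_of_free M hfree) hfree j X hX hr
      interval_cases j <;> omega
    · rcases Nat.lt_or_ge j 5 with h5 | h5
      · have hj4 : j = 4 := by omega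
        subst hj4
        have := ncard_le_ten_of_eRk_le_four_of_free M hfree hX hr
        omega
      · rcases Nat.lt_or_ge j 6 with h6 | h6
        · have hj5 : j = 5 := by omega
          subst hj5
          have := ncard_le_nineteen_of_eRk_le_five_of_free M hfree hX hr
          omega
        · have hj6 : j = 6 := by omega
          subst hj6
          have := ncard_le_thirtynine_of_eRk_le_six_of_free M hfree hX hr
          omega
  have hBq' : ∀ X ⊆ M.E, M.eRk X ≤ 6 → X.ncard ≤ 39 := fun X hX hr => by
    have := hBj 6 le_rfl X hX hr; omega
  have hU : Matroid.topCount M p 6 ≤ n.choose 6 * 2 ^ (39 - 6) := by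
    calc Matroid.topCount M p 6 ≤ Matroid.levelCount M 6 := Matroid.topCount_le_levelCount_bot p 6
      _ = {X : Set α | X ⊆ M.E ∧ M.eRk X = 6}.ncard := rfl
      _ ≤ n.choose 6 * 2 ^ (39 - 6) := by rw [← hEcard]; exact ncard_eRk_eq_le_choose_mul_of_bound M 6 39 hBq'
  have hA := ncard_eRk_le_le_sum_choose_mul_of_bound M 6 39 hBj
  rw [hEcard] at hA
  have hsum := sum_choose_le_mul_pow n 6 (by omega)
  have hpow := pow_six_le_choose_of_89' n (by omega)
  have hA' : {X : Set α | X ⊆ M.E ∧ M.eRk X ≤ 6}.ncard ≤ 7700 * n.choose 6 * 2 ^ 33 := by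
    calc {X : Set α | X ⊆ M.E ∧ M.eRk X ≤ 6}.ncard ≤ (∑ j ∈ Finset.range (6 + 1), n.choose j) * 2 ^ (39 - 6) := hA
      _ ≤ ((6 + 1) * n ^ 6) * 2 ^ (39 - 6) := Nat.mul_le_mul_right _ hsum
      _ ≤ ((6 + 1) * (1100 * n.choose 6)) * 2 ^ (39 - 6) := by gcongr
      _ = 7700 * n.choose 6 * 2 ^ 33 := by ring
  have hY := choose_le_midCount_add_low' (M := M) (p := p) (q := 6) hp
  rw [hEcard] at hY
  have hkey := hkey n hbig
  have hΦ := phiK_le_two_pow_div p 6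
  rw [RLS_iff]
  -- in `ℚ`
  have hc : (0 : ℚ) < ((p + 6).choose p : ℚ) := by exact_mod_cast Nat.choose_pos (Nat.le_add_right p 6)
  have hUq : (Matroid.topCount M p 6 : ℚ) ≤ (n.choose 6 : ℚ) * 2 ^ 33 := by
    have : (Matroid.topCount M p 6 : ℚ) ≤ ((n.choose 6 * 2 ^ (39 - 6) : ℕ) : ℚ) := by exact_mod_cast hU
    push_cast at this
    norm_num at this ⊢
    exact this
  have hU0 : (0 : ℚ) ≤ (Matroid.topCount M p 6 : ℚ) := by positivity
  have hYq : (n.choose (p - 1) : ℚ) ≤ (Matroid.midCount M p 6 : ℚ) +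
      ({X : Set α | X ⊆ M.E ∧ M.eRk X ≤ 6}.ncard : ℚ) := by exact_mod_cast hY
  have hAq : ({X : Set α | X ⊆ M.E ∧ M.eRk X ≤ 6}.ncard : ℚ) ≤ 7700 * (n.choose 6 : ℚ) * 2 ^ 33 := by
    exact_mod_cast hA'
  have hkeyq : ((2 : ℚ) ^ (p + 6) + 7700 * ((p + 6).choose p : ℚ)) * 2 ^ 33 * (n.choose 6 : ℚ) ≤
      ((p + 6).choose p : ℚ) * (n.choose (p - 1) : ℚ) := by exact_mod_cast hkey
  have hΦ0 : (0 : ℚ) ≤ (2 ^ (p + 6) : ℚ) / ((p + 6).choose p : ℚ) := by positivity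
  calc phiK p 6 * (Matroid.topCount M p 6 : ℚ)
      ≤ ((2 ^ (p + 6) : ℚ) / ((p + 6).choose p : ℚ)) * ((n.choose 6 : ℚ) * 2 ^ 33) :=
        mul_le_mul hΦ hUq hU0 hΦ0
    _ = ((2 : ℚ) ^ (p + 6) * 2 ^ 33 * (n.choose 6 : ℚ)) / ((p + 6).choose p : ℚ) := by ring
    _ ≤ (n.choose (p - 1) : ℚ) - 7700 * (n.choose 6 : ℚ) * 2 ^ 33 := by
        rw [div_le_iff₀ hc]
        nlinarith [hkeyq]
    _ ≤ (Matroid.midCount M p 6 : ℚ) := by linarith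

/-- The key with the subtracted term at `n = p + 51`, for `38 ≤ p ≤ 51` — fourteen numerals, decided. -/
theorem key_six_sub_of_le_51'' (p : ℕ) (hp : 38 ≤ p) (hp' : p ≤ 51) :
    (2 ^ (p + 6) + 7700 * (p + 6).choose p) * 2 ^ 33 * (p + 51).choose 6 ≤ (p + 6).choose p * (p + 51).choose (p - 1) := by
  interval_cases p <;> decide

/-- **The `e`-free core at level `6`, every corank `≥ 51`, every rank `p ≥ 38`** (`p ≥ 52`: RankLevelSetCoreSixFiftyTwo;
`38 ≤ p ≤ 51`: the subtracted-term key decided at `n₀ = p + 51 ≤ |E|`, `n₀ ≥ 89`). -/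
theorem c025_core_six_thirtynine_thirtyeight' (M : Matroid α) [M.Finite] (p : ℕ) (hp : 38 ≤ p)
    (hR : M.eRank = (p : ℕ∞)) (hbig : p + 50 < M.E.ncard)
    (hfree : ∀ e ∈ M.E, ∃ A ⊆ M.E \ {e}, e ∉ M.closure A ∧ e ∉ M.closure ((M.E \ {e}) \ A)) : RLS M p 6 := by
  rcases Nat.lt_or_ge p 52 with hlt | hge
  · refine core_six_corank_of_key_sub' (p + 51) (by omega) M p (by omega) ?_ (by omega) hfree
    exact key_of_base' p 6 ((2 ^ (p + 6) + 7700 * (p + 6).choose p) * 2 ^ 33) ((p + 6).choose p) (p + 51)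
      (by omega) (by omega) (by omega) (key_six_sub_of_le_51'' p hp (by omega))
  · exact c025_core_six_fortythree_fiftytwo M p hge hR hbig hfree

/-- The key with the subtracted term at `p = 37`, `n = 89` — one numeral, decided. -/
theorem key_six_sub_37_89' :
    (2 ^ 43 + 7700 * Nat.choose 43 37) * 2 ^ 33 * Nat.choose 89 6 ≤ Nat.choose 43 37 * Nat.choose 89 36 := by
  decide

/-- **The `e`-free core at level `6`, every corank `≥ 52`, every rank `p ≥ 37`** (`p ≥ 38`: the theorem above, whose
hypothesis `p + 50 < |E|` is implied; `p = 37`: the key decided at `n₀ = 89 = p + 52 ≤ |E|`; the key is FALSE at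
`n₀ = 88`). -/
theorem c025_core_six_thirtynine_thirtyseven' (M : Matroid α) [M.Finite] (p : ℕ) (hp : 37 ≤ p)
    (hR : M.eRank = (p : ℕ∞)) (hbig : p + 51 < M.E.ncard)
    (hfree : ∀ e ∈ M.E, ∃ A ⊆ M.E \ {e}, e ∉ M.closure A ∧ e ∉ M.closure ((M.E \ {e}) \ A)) : RLS M p 6 := by
  rcases Nat.lt_or_ge p 38 with hlt | hge
  · have hp37 : p = 37 := by omega
    subst hp37
    refine core_six_corank_of_key_sub' 89 le_rfl M 37 (by norm_num) ?_ (by omega) hfree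
    have hk := key_of_base' 37 6 ((2 ^ 43 + 7700 * Nat.choose 43 37) * 2 ^ 33) (Nat.choose 43 37) 89
      (by norm_num) (by norm_num) (by norm_num) key_six_sub_37_89'
    intro n hn
    have := hk n hn
    simpa using this
  · exact c025_core_six_thirtynine_thirtyeight' M p hge hR (by omega) hfree

end ThmN

end PercRepro
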